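import Summits.BirchSwinnertonDyer.BirchSwinnertonDyer.Theorems.ManinLocalTwoThreeStevensCuspRational
import Summits.BirchSwinnertonDyer.BirchSwinnertonDyer.Theorems.ManinLocalTwoThreeShimuraQuotientRational
import Literature.NumberTheory.EllipticCurves.ManinConstantQuadraticTwist
import Literature.NumberTheory.EllipticCurves.MazurTorsionOrderValuationProofs
import Literature.NumberTheory.EllipticCurves.ModularCurveManinConstantProofs
import Literature.NumberTheory.EllipticCurves.PeriodLatticeGamma1QuotientProofs
import HarnessLib

/-!
# Česnavičius 2018 Lemma 2.12 (the Shimura cover `E₁ → E₀` has constant kernel) — the tree's named fact PROVED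

The named Literature fact `cesnavicius2018_lemma_2_12_constKernel`
(`Literature/NumberTheory/EllipticCurves/ManinConstantQuadraticTwist.lean`; Česnavičius 2018 Lemma 2.12 at
`(H, H') = (Γ₁(N), Γ₀(N))` = ČNS Lemma 6.5 = Vatsal 2005 Remark 1.8, as rendered: for globally minimal `W₁ ∼ W₀`, an
OPTIMAL `X₁(N)`-datum `D₁` of `W₁` (`Λ_{W₁} = c₁Λ₁(f)`) and a lattice-optimal `X₀(N)`-datum `D₀` of `W₀` (`Λ_{W₀} = c₀Λ₀(f)`)
there is `k ≥ 1` with `k ∣ #W₁(ℚ)_tors`, `(c₀/c₁)Λ_{W₁} ⊆ Λ_{W₀}` and `(k c₁/c₀)Λ_{W₀} ⊆ Λ_{W₁}`) is DISCHARGED here,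
`cesnavicius2018_lemma_2_12_constKernel_holds`, from tree theorems only:

* multiplicity one (`IsNewformOf.unique`, `IsNewformOf.of_isIsogenous`): `D₁.f = D₀.f =: f`;
* `Λ₁(f) ⊆ Λ₀(f)` (`periodLatticeGamma1_le_periodLattice`) and `c₀Λ₀(f) ⊆ Λ_{W₀}` give `(c₀/c₁)Λ_{W₁} = c₀Λ₁(f) ⊆ Λ_{W₀}`;
* **the Shimura quotient `Λ₀(f)/Λ₁(f)` is killed by `#W₁(ℚ)_tors`** (`torsionOrder_mul_mem_periodLatticeGamma1`, the one new
  lemma): every `u₁(c₁w)`, `w ∈ Λ₀(f)`, is a RATIONAL point of Stevens' curve `W₁` (F★ =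
  `optimalGamma1Parametrization_cusp_rational`, PROVED in the tree: `StevensGalois.optimalGamma1Parametrization_cusp_rational_holds`,
  Stevens 1982 Thm. 1.3.1 / CES §6.1.2), torsion (`φ(N)Λ₀ ⊆ Λ₁`, `totient_nsmul_uniformize_eq_zero`), so of order dividing
  `#W₁(ℚ)_tors` (`addOrderOf_dvd_torsionOrder`); hence `#W₁(ℚ)_tors · c₁ w ∈ Λ_{W₁} = c₁Λ₁(f)`.  With `k := #W₁(ℚ)_tors`:
  `(k c₁/c₀)Λ_{W₀} = k c₁ Λ₀(f) ⊆ Λ_{W₁}`.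

So the printed "`Ker e` is constant, `#Ker e ∣ #E₁(ℚ)_tors`" is replaced by the (weaker, sufficient) exponent statement with
`k = #E₁(ℚ)_tors` itself, which the rendering allows (`∃ k, 0 < k ∧ k ∣ #E₁(ℚ)_tors ∧ …`).
BSD is not proved here; no Manin constant is computed; nothing about C2/C3 changes.
-/

set_option autoImplicit false

set_option linter.dupNamespace false

noncomputable section

open scoped MatrixGroups ModularForm
open CongruenceSubgroup
open WeierstrassCurve Literature.NumberTheory.EllipticCurves Literature.NumberTheory.EllipticCurves.ModularForms
open Summit.BirchSwinnertonDyer.BirchSwinnertonDyer.Theorems.ManinLocalTwoThree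
  (gamma1_uniformize_eq_zero_iff exists_point_eq_uniformize_of_mem_periodLattice totient_nsmul_uniformize_eq_zero)
open Summit.BirchSwinnertonDyer.BirchSwinnertonDyer.Theorems.ManinLocalTwoThree.StevensGalois
  (optimalGamma1Parametrization_cusp_rational_holds)

namespace Summit.BirchSwinnertonDyer.BirchSwinnertonDyer.Theorems.ManinLocalTwoThree.StevensIntegrality

variable {N : ℕ} [NeZero N]

/-- **The Shimura quotient `Λ₀(f)/Λ₁(f)` is killed by `#W₁(ℚ)_tors`.**  For an OPTIMAL `X₁(N)`-datum `D` of an elliptic `W/ℚ`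
(`Λ_W = c·Λ₁(f)`: `W` is Stevens' curve of its class on this model) and `w ∈ Λ₀(f)`, `#W(ℚ)_tors · w ∈ Λ₁(f)`: the point
`u(c w)` is rational (F★, `optimalGamma1Parametrization_cusp_rational_holds`) and torsion (`φ(N)·w ∈ Λ₁(f)`), so its order divides
`#W(ℚ)_tors`, i.e. `#W(ℚ)_tors · c w ∈ Λ_W = cΛ₁(f)`. [cite: Stevens1989, §2] [cite: ConradEdixhovenStein2003, §6.1.2 and §6.2]
[cite: LingOesterle1991, §1 and Thm. 1] -/
theorem torsionOrder_mul_mem_periodLatticeGamma1 {W : WeierstrassCurve ℚ} [W.IsElliptic]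
    (D : Gamma1ParametrizationData W N) (hD : D.IsOptimal) {w : ℂ} (hw : w ∈ periodLattice D.f) :
    (W.torsionOrder : ℂ) * w ∈ periodLatticeGamma1 D.f := by
  obtain ⟨P, hP⟩ := exists_point_eq_uniformize_of_mem_periodLattice optimalGamma1Parametrization_cusp_rational_holds D hD hw
  have hc : (D.c : ℂ) ≠ 0 := by exact_mod_cast D.maninConstant_ne_zero
  have hinj := Affine.Point.map_injective (W' := W) (f := Algebra.ofId ℚ ℂ)
  -- `P` is torsion: `φ(N) • P = 0`
  have hφP : Nat.totient N • P = 0 := by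
    apply hinj
    rw [map_nsmul, map_zero]
    change Nat.totient N • Affine.Point.baseChange (W' := W) ℚ ℂ P = 0
    rw [hP]
    exact totient_nsmul_uniformize_eq_zero D hw
  have hfin : IsOfFinAddOrder P :=
    isOfFinAddOrder_iff_nsmul_eq_zero.mpr ⟨Nat.totient N, Nat.totient_pos.mpr (NeZero.pos N), hφP⟩
  -- so `#W(ℚ)_tors • P = 0`
  have hTP : W.torsionOrder • P = 0 :=
    addOrderOf_dvd_iff_nsmul_eq_zero.mp (addOrderOf_dvd_torsionOrder W hfin)
  -- read in `ℂ/Λ_W`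
  have hmem : (W.torsionOrder : ℂ) * ((D.c : ℂ) * w) ∈ D.L.lattice := by
    rw [← gamma1_uniformize_eq_zero_iff, ← nsmul_eq_mul, map_nsmul, ← hP, ← map_nsmul, hTP, map_zero]
  rw [← mul_assoc, mul_comm (W.torsionOrder : ℂ), mul_assoc] at hmem
  obtain ⟨w', hw', h⟩ := hD _ hmem
  rwa [mul_left_cancel₀ hc h]

/-- **Česnavičius 2018 Lemma 2.12 (constant kernel of the Shimura cover), the tree's named fact — PROVED.**  For globally
minimal `W₁ ∼ W₀`, an optimal `X₁(N)`-datum `D₁` of `W₁` and a lattice-optimal `X₀(N)`-datum `D₀` of `W₀`: with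
`k := #W₁(ℚ)_tors` (`0 < k`, `k ∣ #W₁(ℚ)_tors`), `(c₀/c₁)Λ_{W₁} ⊆ Λ_{W₀}` and `(k c₁/c₀)Λ_{W₀} ⊆ Λ_{W₁}` — by multiplicity one
(`D₁.f = D₀.f`), `Λ₁(f) ⊆ Λ₀(f)`, and `torsionOrder_mul_mem_periodLatticeGamma1`.
[cite: Cesnavicius2018, Lemma 2.12] [cite: CesnaviciusNeururerSaha2023, Lemma 6.5] [cite: Vatsal2005, Remark 1.8]
[cite: Stevens1989, §2] -/
theorem cesnavicius2018_lemma_2_12_constKernel_holds : cesnavicius2018_lemma_2_12_constKernel := by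
  intro W₁ W₀ _ _ _ _ N _ D₁ D₀ hiso hopt₁ h₀
  -- multiplicity one: the two data carry the same newform
  have hf : D₁.f = D₀.f := D₁.isNewformOf.unique (D₀.isNewformOf.of_isIsogenous hiso)
  have hc₁ : (D₁.c : ℂ) ≠ 0 := by exact_mod_cast D₁.maninConstant_ne_zero
  have hc₀ : (D₀.c : ℂ) ≠ 0 := by exact_mod_cast ModularParametrizationData.maninConstant_ne_zero_holds D₀
  refine ⟨W₁.torsionOrder, W₁.torsionOrder_pos_holds, dvd_rfl, ?_, ?_⟩
  · -- `(c₀/c₁) Λ_{W₁} = c₀ Λ₁(f) ⊆ c₀ Λ₀(f) ⊆ Λ_{W₀}`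
    intro z hz
    obtain ⟨w, hw, rfl⟩ := hopt₁ z hz
    have hw₀ : w ∈ periodLattice D₀.f := hf ▸ periodLatticeGamma1_le_periodLattice D₁.f hw
    have : (D₀.c : ℂ) / (D₁.c : ℂ) * ((D₁.c : ℂ) * w) = (D₀.c : ℂ) * w := by
      field_simp
    rw [this]
    exact D₀.smul_periodLattice_le w hw₀
  · -- `(k c₁/c₀) Λ_{W₀} = k c₁ Λ₀(f) ⊆ c₁ Λ₁(f) ⊆ Λ_{W₁}`
    intro z hz
    obtain ⟨w, hw, rfl⟩ := h₀ z hz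
    have hw₁ : w ∈ periodLattice D₁.f := by rw [hf]; exact hw
    have : (W₁.torsionOrder : ℂ) * (D₁.c : ℂ) / (D₀.c : ℂ) * ((D₀.c : ℂ) * w) =
        (D₁.c : ℂ) * ((W₁.torsionOrder : ℂ) * w) := by
      field_simp
    rw [this]
    exact D₁.smul_periodLatticeGamma1_le _ (torsionOrder_mul_mem_periodLatticeGamma1 D₁ hopt₁ hw₁)

end Summit.BirchSwinnertonDyer.BirchSwinnertonDyer.Theorems.ManinLocalTwoThree.StevensIntegrality

end
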